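import Summits.CriticalPhenomena.PercolationContinuityZ3.Theorems.PercNearOneGluingNoHeavyLowerTailSahiTwoLevelIndependentTops

/-!
# An ELEMENTARY certificate for both two-level laws at independent tops (block bottoms), with an explicit positive margin

Companion of `…SahiTwoLevelIndependentTops` (cell `prim-bnk`, seat bnk-2 gen 17; `--supports stmt-CriticalPhenomena-4575`; memo
`run/shared/lean/prim/prim-l12/FROM-prim-bnk-2-g17-POLARIZATION.md` §9).  No definition, no sorry, standard axioms.

SETTING.  `μ = prodBernoulli q`; a nested pair `H ⊆ G` of triples of increasing events whose slot-`0` events `G 0 ⊇ H 0` are determined by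
the coins OUTSIDE a finite set `T` and whose slot-`1` events `G 1 ⊇ H 1` are determined by the coins IN `T` ("independent tops, block
bottoms"); `G 2 ⊇ H 2` arbitrary.  Write `a¹ = μ(G 0) ≥ a⁰ = μ(H 0)`, `b¹ = μ(G 1) ≥ b⁰ = μ(H 1)`, `u¹ = μ(G 2) ≥ u⁰ = μ(H 2)`,
`Δ₊ = a¹b⁰ + a⁰b¹ − a⁰b⁰`.

**THEOREM (`twoLevelForm_mul_ge`, `twoLevelPlus_mul_ge`).**
  `Δ₊·a¹b¹ · T(G,H) ≥ a⁰b⁰a¹b¹(a¹−a⁰)(b¹−b⁰)·u⁰`  and  `Δ₊·a¹b¹ · T⁺(G,H) ≥ a⁰b⁰a¹b¹(a¹−a⁰)(b¹−b⁰)·u¹`,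
where `T = twoLevelForm` ("C₃-M⁻") and `T⁺ = T − ∏δ` ("C₃-M⁺").  Both right-hand sides are `≥ 0`.

The point is the PROOF: unlike the interpolation argument of `…SahiTwoLevelIndependentTops` (corner rows + a configuration-dependent
convex combination), each inequality here is an explicit IDENTITY
  `Δ₊a¹b¹·T − (margin) = a¹b¹·{a¹b⁰·F₁ + a⁰b¹·F₂ + (b⁰Δa + a⁰Δb)·(F₃ + F₄ + F₇)} + Δ₊·{a⁰b¹·F₅ + a¹b⁰·F₆} + Δ₊(2a¹b¹−a⁰b¹−a¹b⁰)·F₈ + κ·F₉`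
(`κ = (Δ₊ + a⁰b⁰)ΔaΔb`) in NINE elementary nonnegative quantities: six Harris covariances `F₁ = Cov(H0, H1∩H2)`, `F₂ = Cov(H1, H0∩H2)`,
`F₃ = Cov(G1, H0∩H2)`, `F₄ = Cov(G0, H1∩H2)` (the last two pair a TOP with the other slots' BOTTOMS — "cross-level Harris"),
`F₅ = Cov(G0, G1∩G2)`, `F₆ = Cov(G1, G0∩G2)`; the inclusion–exclusion count `F₇ = μ(H0H1H2) − μ(H0G1H2) − μ(G0H1H2) + μ(G0G1H2)
= μ((G0∖H0)(G1∖H1)H2) ≥ 0`; the monotonicity `F₈ = μ(G0G1G2) − μ(G0G1H2)`; and `F₉ = μ(G0∩G1∩H2) − a¹b¹u⁰` (Harris for `G0∩G1` and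
`H2` plus independence).  For `T⁺` the same identity holds with `F₈` weighted `a¹b¹(b⁰Δa + a⁰Δb)` and `F₉' = μ(G0G1G2) − a¹b¹u¹`.
The multipliers were read off the optimal dual of a small linear programme (memo §8–§9); every step is Harris / monotonicity /
independence, so the certificate is a sum of products of quantities each of which POLARISES along a further shared coin — the
motivation (rung `k = 1` of the shared-coins ladder, `…SahiTwoLevelSharedLadder(Bottom)`), see the memo.  As corollaries the two laws
`T ≥ 0`, `T⁺ ≥ 0` at block bottoms follow WITHOUT interpolation whenever `Δ₊a¹b¹ > 0` (`twoLevelLaws_of_blocks`); the general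
case (arbitrary nested bottoms) remains `…IndependentTops`. [this work]
-/

noncomputable section

open scoped Classical

namespace Summit.CriticalPhenomena.PercolationContinuityZ3.Theorems

namespace SahiTwoLevelIndep

open Finset MeasureTheory
open Literature.Combinatorics.Sahi2008
open Literature.Probability.LatticeModels (prodBernoulli prodBernoulli_harris prodBernoulli_real_inter_of_determinedBy)
open Literature.Probability.Percolation (DeterminedBy)

variable {ι : Type} [Fintype ι]

/-- Inclusion–exclusion for a nested pair: `μ(G0∩H1∩H2) + μ(H0∩G1∩H2) ≤ μ(G0∩G1∩H2) + μ(H0∩H1∩H2)` (the difference is the measure of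
`(G0∖H0) ∩ (G1∖H1) ∩ H2`). [folklore] -/
theorem incl_excl_nested (q : ι → unitInterval) {G0 G1 H0 H1 H2 : Set (Set ι)} (h0 : H0 ⊆ G0) (h1 : H1 ⊆ G1) :
    (prodBernoulli q).real (G0 ∩ H1 ∩ H2) + (prodBernoulli q).real (H0 ∩ G1 ∩ H2) ≤
      (prodBernoulli q).real (G0 ∩ G1 ∩ H2) + (prodBernoulli q).real (H0 ∩ H1 ∩ H2) := by
  have hm : ∀ X : Set (Set ι), MeasurableSet X := fun _ => MeasurableSet.of_discrete
  have hu : (prodBernoulli q).real ((G0 ∩ H1 ∩ H2) ∪ (H0 ∩ G1 ∩ H2))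
      + (prodBernoulli q).real ((G0 ∩ H1 ∩ H2) ∩ (H0 ∩ G1 ∩ H2)) =
      (prodBernoulli q).real (G0 ∩ H1 ∩ H2) + (prodBernoulli q).real (H0 ∩ G1 ∩ H2) :=
    measureReal_union_add_inter (hm _)
  have hcap : (G0 ∩ H1 ∩ H2) ∩ (H0 ∩ G1 ∩ H2) = H0 ∩ H1 ∩ H2 := by
    ext ω
    simp only [Set.mem_inter_iff]
    constructor
    · rintro ⟨⟨⟨_, hH1⟩, hH2⟩, ⟨hH0, _⟩, _⟩; exact ⟨⟨hH0, hH1⟩, hH2⟩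
    · rintro ⟨⟨hH0, hH1⟩, hH2⟩; exact ⟨⟨⟨h0 hH0, hH1⟩, hH2⟩, ⟨hH0, h1 hH1⟩, hH2⟩
  have hsub : (G0 ∩ H1 ∩ H2) ∪ (H0 ∩ G1 ∩ H2) ⊆ G0 ∩ G1 ∩ H2 := by
    rintro ω (⟨⟨hG0, hH1⟩, hH2⟩ | ⟨⟨hH0, hG1⟩, hH2⟩)
    · exact ⟨⟨hG0, h1 hH1⟩, hH2⟩
    · exact ⟨⟨h0 hH0, hG1⟩, hH2⟩
  have hmono := measureReal_mono (μ := prodBernoulli q) hsub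
  rw [hcap] at hu
  linarith

/-- **THE BOTTOM LAW WITH A MARGIN (independent tops, block bottoms), elementary certificate.**
`Δ₊·a¹b¹·twoLevelForm μ G H ≥ a⁰b⁰a¹b¹(a¹−a⁰)(b¹−b⁰)·μ(H 2)`, `Δ₊ = a¹b⁰ + a⁰b¹ − a⁰b⁰`; see the file docstring for the nine-term identity
behind it. [this work] -/
theorem twoLevelForm_mul_ge (q : ι → unitInterval) (T : Finset ι) (G H : Fin 3 → Set (Set ι))
    (hG : ∀ i, IsUpperSet (G i)) (hH : ∀ i, IsUpperSet (H i)) (hHG : ∀ i, H i ⊆ G i)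
    (hG0 : DeterminedBy (G 0) (↑T : Set ι)ᶜ) (hG1 : DeterminedBy (G 1) (↑T : Set ι))
    (hH0 : DeterminedBy (H 0) (↑T : Set ι)ᶜ) (hH1 : DeterminedBy (H 1) (↑T : Set ι)) :
    (prodBernoulli q).real (H 0) * (prodBernoulli q).real (H 1) * (prodBernoulli q).real (G 0) * (prodBernoulli q).real (G 1) * ((prodBernoulli q).real (G 0) - (prodBernoulli q).real (H 0)) * ((prodBernoulli q).real (G 1) - (prodBernoulli q).real (H 1)) * (prodBernoulli q).real (H 2)
      ≤ ((prodBernoulli q).real (G 0) * (prodBernoulli q).real (H 1) + (prodBernoulli q).real (H 0) * (prodBernoulli q).real (G 1) - (prodBernoulli q).real (H 0) * (prodBernoulli q).real (H 1)) * (prodBernoulli q).real (G 0) * (prodBernoulli q).real (G 1) * twoLevelForm (fun A => (prodBernoulli q).real A) G H := by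
  have hm : ∀ X : Set (Set ι), MeasurableSet X := fun _ => MeasurableSet.of_discrete
  have iGG : (prodBernoulli q).real (G 0 ∩ G 1) = (prodBernoulli q).real (G 0) * (prodBernoulli q).real (G 1) := by
    have h := prodBernoulli_real_inter_of_determinedBy q T hG1 hG0 (hm _) (hm _)
    rw [Set.inter_comm] at h; rw [h, mul_comm]
  have iHH : (prodBernoulli q).real (H 0 ∩ H 1) = (prodBernoulli q).real (H 0) * (prodBernoulli q).real (H 1) := by
    have h := prodBernoulli_real_inter_of_determinedBy q T hH1 hH0 (hm _) (hm _)
    rw [Set.inter_comm] at h; rw [h, mul_comm]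
  have e1 : H 0 ∩ (H 1 ∩ H 2) = H 0 ∩ H 1 ∩ H 2 := (Set.inter_assoc _ _ _).symm
  have e2 : H 1 ∩ (H 0 ∩ H 2) = H 0 ∩ H 1 ∩ H 2 := by
    ext ω; simp only [Set.mem_inter_iff]; tauto
  have e3 : G 1 ∩ (H 0 ∩ H 2) = H 0 ∩ G 1 ∩ H 2 := by
    ext ω; simp only [Set.mem_inter_iff]; tauto
  have e4 : G 0 ∩ (H 1 ∩ H 2) = G 0 ∩ H 1 ∩ H 2 := (Set.inter_assoc _ _ _).symm
  have e5 : G 0 ∩ (G 1 ∩ G 2) = G 0 ∩ G 1 ∩ G 2 := (Set.inter_assoc _ _ _).symm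
  have e6 : G 1 ∩ (G 0 ∩ G 2) = G 0 ∩ G 1 ∩ G 2 := by
    ext ω; simp only [Set.mem_inter_iff]; tauto
  have F1 := prodBernoulli_harris q (hH 0) ((hH 1).inter (hH 2)) (hm _) (hm _)
  have F2 := prodBernoulli_harris q (hH 1) ((hH 0).inter (hH 2)) (hm _) (hm _)
  have F3 := prodBernoulli_harris q (hG 1) ((hH 0).inter (hH 2)) (hm _) (hm _)
  have F4 := prodBernoulli_harris q (hG 0) ((hH 1).inter (hH 2)) (hm _) (hm _)
  have F5 := prodBernoulli_harris q (hG 0) ((hG 1).inter (hG 2)) (hm _) (hm _)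
  have F6 := prodBernoulli_harris q (hG 1) ((hG 0).inter (hG 2)) (hm _) (hm _)
  rw [e1] at F1; rw [e2] at F2; rw [e3] at F3; rw [e4] at F4; rw [e5] at F5; rw [e6] at F6
  have F7 := incl_excl_nested q (H2 := H 2) (hHG 0) (hHG 1)
  have F8 : (prodBernoulli q).real (G 0 ∩ G 1 ∩ H 2) ≤ (prodBernoulli q).real (G 0 ∩ G 1 ∩ G 2) :=
    measureReal_mono (Set.inter_subset_inter_right _ (hHG 2))
  have ma : (prodBernoulli q).real (H 0) ≤ (prodBernoulli q).real (G 0) := measureReal_mono (hHG 0)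
  have mb : (prodBernoulli q).real (H 1) ≤ (prodBernoulli q).real (G 1) := measureReal_mono (hHG 1)
  have na0 : 0 ≤ (prodBernoulli q).real (H 0) := measureReal_nonneg
  have nb0 : 0 ≤ (prodBernoulli q).real (H 1) := measureReal_nonneg
  have na1 : 0 ≤ (prodBernoulli q).real (G 0) := measureReal_nonneg
  have nb1 : 0 ≤ (prodBernoulli q).real (G 1) := measureReal_nonneg
  have hda : 0 ≤ ((prodBernoulli q).real (G 0) - (prodBernoulli q).real (H 0)) := sub_nonneg.2 ma
  have hdb : 0 ≤ ((prodBernoulli q).real (G 1) - (prodBernoulli q).real (H 1)) := sub_nonneg.2 mb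
  have hΔ : 0 ≤ ((prodBernoulli q).real (G 0) * (prodBernoulli q).real (H 1) + (prodBernoulli q).real (H 0) * (prodBernoulli q).real (G 1) - (prodBernoulli q).real (H 0) * (prodBernoulli q).real (H 1)) := by nlinarith [mul_nonneg na1 nb0, mul_nonneg na0 hdb]
  have hy : 0 ≤ (prodBernoulli q).real (H 1) * ((prodBernoulli q).real (G 0) - (prodBernoulli q).real (H 0)) + (prodBernoulli q).real (H 0) * ((prodBernoulli q).real (G 1) - (prodBernoulli q).real (H 1)) := add_nonneg (mul_nonneg nb0 hda) (mul_nonneg na0 hdb)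
  have P1 : 0 ≤ (prodBernoulli q).real (H 0 ∩ H 1 ∩ H 2) - (prodBernoulli q).real (H 0) * (prodBernoulli q).real (H 1 ∩ H 2) := by linarith
  have P2 : 0 ≤ (prodBernoulli q).real (H 0 ∩ H 1 ∩ H 2) - (prodBernoulli q).real (H 1) * (prodBernoulli q).real (H 0 ∩ H 2) := by linarith
  have P3 : 0 ≤ (prodBernoulli q).real (H 0 ∩ G 1 ∩ H 2) - (prodBernoulli q).real (G 1) * (prodBernoulli q).real (H 0 ∩ H 2) := by linarith
  have P4 : 0 ≤ (prodBernoulli q).real (G 0 ∩ H 1 ∩ H 2) - (prodBernoulli q).real (G 0) * (prodBernoulli q).real (H 1 ∩ H 2) := by linarith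
  have P5 : 0 ≤ (prodBernoulli q).real (G 0 ∩ G 1 ∩ G 2) - (prodBernoulli q).real (G 0) * (prodBernoulli q).real (G 1 ∩ G 2) := by linarith
  have P6 : 0 ≤ (prodBernoulli q).real (G 0 ∩ G 1 ∩ G 2) - (prodBernoulli q).real (G 1) * (prodBernoulli q).real (G 0 ∩ G 2) := by linarith
  have P7 : 0 ≤ (prodBernoulli q).real (H 0 ∩ H 1 ∩ H 2) - (prodBernoulli q).real (H 0 ∩ G 1 ∩ H 2) - (prodBernoulli q).real (G 0 ∩ H 1 ∩ H 2) + (prodBernoulli q).real (G 0 ∩ G 1 ∩ H 2) := by linarith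
  have P8 : 0 ≤ (prodBernoulli q).real (G 0 ∩ G 1 ∩ G 2) - (prodBernoulli q).real (G 0 ∩ G 1 ∩ H 2) := by linarith
  have F9 := prodBernoulli_harris q ((hG 0).inter (hG 1)) (hH 2) (hm _) (hm _)
  rw [iGG] at F9
  have P9 : 0 ≤ (prodBernoulli q).real (G 0 ∩ G 1 ∩ H 2) - (prodBernoulli q).real (G 0) * (prodBernoulli q).real (G 1) * (prodBernoulli q).real (H 2) := by linarith
  simp only [twoLevelForm, iGG, iHH]
  linarith [mul_nonneg (mul_nonneg (mul_nonneg na1 nb1) (mul_nonneg na1 nb0)) P1,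
    mul_nonneg (mul_nonneg (mul_nonneg na1 nb1) (mul_nonneg na0 nb1)) P2,
    mul_nonneg (mul_nonneg (mul_nonneg na1 nb1) hy) P3,
    mul_nonneg (mul_nonneg (mul_nonneg na1 nb1) hy) P4,
    mul_nonneg (mul_nonneg (mul_nonneg na1 nb1) hy) P7,
    mul_nonneg (mul_nonneg hΔ (mul_nonneg na0 nb1)) P5,
    mul_nonneg (mul_nonneg hΔ (mul_nonneg na1 nb0)) P6,
    mul_nonneg (mul_nonneg hΔ (by nlinarith [mul_nonneg hda nb1, mul_nonneg na1 hdb] : (0:ℝ) ≤ 2 * (prodBernoulli q).real (G 0) * (prodBernoulli q).real (G 1) - (prodBernoulli q).real (H 0) * (prodBernoulli q).real (G 1) - (prodBernoulli q).real (G 0) * (prodBernoulli q).real (H 1))) P8,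
    mul_nonneg (mul_nonneg (add_nonneg hΔ (mul_nonneg na0 nb0)) (mul_nonneg hda hdb)) P9]

/-- **THE TOP LAW WITH A MARGIN (independent tops, block bottoms), elementary certificate.**
`Δ₊·a¹b¹·(twoLevelForm μ G H − ∏δ) ≥ a⁰b⁰a¹b¹(a¹−a⁰)(b¹−b⁰)·μ(G 2)`. [this work] -/
theorem twoLevelPlus_mul_ge (q : ι → unitInterval) (T : Finset ι) (G H : Fin 3 → Set (Set ι))
    (hG : ∀ i, IsUpperSet (G i)) (hH : ∀ i, IsUpperSet (H i)) (hHG : ∀ i, H i ⊆ G i)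
    (hG0 : DeterminedBy (G 0) (↑T : Set ι)ᶜ) (hG1 : DeterminedBy (G 1) (↑T : Set ι))
    (hH0 : DeterminedBy (H 0) (↑T : Set ι)ᶜ) (hH1 : DeterminedBy (H 1) (↑T : Set ι)) :
    (prodBernoulli q).real (H 0) * (prodBernoulli q).real (H 1) * (prodBernoulli q).real (G 0) * (prodBernoulli q).real (G 1) * ((prodBernoulli q).real (G 0) - (prodBernoulli q).real (H 0)) * ((prodBernoulli q).real (G 1) - (prodBernoulli q).real (H 1)) * (prodBernoulli q).real (G 2)
      ≤ ((prodBernoulli q).real (G 0) * (prodBernoulli q).real (H 1) + (prodBernoulli q).real (H 0) * (prodBernoulli q).real (G 1) - (prodBernoulli q).real (H 0) * (prodBernoulli q).real (H 1)) * (prodBernoulli q).real (G 0) * (prodBernoulli q).real (G 1) * (twoLevelForm (fun A => (prodBernoulli q).real A) G H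
          - ∏ i, ((prodBernoulli q).real (G i) - (prodBernoulli q).real (H i))) := by
  have hm : ∀ X : Set (Set ι), MeasurableSet X := fun _ => MeasurableSet.of_discrete
  have iGG : (prodBernoulli q).real (G 0 ∩ G 1) = (prodBernoulli q).real (G 0) * (prodBernoulli q).real (G 1) := by
    have h := prodBernoulli_real_inter_of_determinedBy q T hG1 hG0 (hm _) (hm _)
    rw [Set.inter_comm] at h; rw [h, mul_comm]
  have iHH : (prodBernoulli q).real (H 0 ∩ H 1) = (prodBernoulli q).real (H 0) * (prodBernoulli q).real (H 1) := by
    have h := prodBernoulli_real_inter_of_determinedBy q T hH1 hH0 (hm _) (hm _)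
    rw [Set.inter_comm] at h; rw [h, mul_comm]
  have e1 : H 0 ∩ (H 1 ∩ H 2) = H 0 ∩ H 1 ∩ H 2 := (Set.inter_assoc _ _ _).symm
  have e2 : H 1 ∩ (H 0 ∩ H 2) = H 0 ∩ H 1 ∩ H 2 := by
    ext ω; simp only [Set.mem_inter_iff]; tauto
  have e3 : G 1 ∩ (H 0 ∩ H 2) = H 0 ∩ G 1 ∩ H 2 := by
    ext ω; simp only [Set.mem_inter_iff]; tauto
  have e4 : G 0 ∩ (H 1 ∩ H 2) = G 0 ∩ H 1 ∩ H 2 := (Set.inter_assoc _ _ _).symm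
  have e5 : G 0 ∩ (G 1 ∩ G 2) = G 0 ∩ G 1 ∩ G 2 := (Set.inter_assoc _ _ _).symm
  have e6 : G 1 ∩ (G 0 ∩ G 2) = G 0 ∩ G 1 ∩ G 2 := by
    ext ω; simp only [Set.mem_inter_iff]; tauto
  have F1 := prodBernoulli_harris q (hH 0) ((hH 1).inter (hH 2)) (hm _) (hm _)
  have F2 := prodBernoulli_harris q (hH 1) ((hH 0).inter (hH 2)) (hm _) (hm _)
  have F3 := prodBernoulli_harris q (hG 1) ((hH 0).inter (hH 2)) (hm _) (hm _)
  have F4 := prodBernoulli_harris q (hG 0) ((hH 1).inter (hH 2)) (hm _) (hm _)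
  have F5 := prodBernoulli_harris q (hG 0) ((hG 1).inter (hG 2)) (hm _) (hm _)
  have F6 := prodBernoulli_harris q (hG 1) ((hG 0).inter (hG 2)) (hm _) (hm _)
  rw [e1] at F1; rw [e2] at F2; rw [e3] at F3; rw [e4] at F4; rw [e5] at F5; rw [e6] at F6
  have F7 := incl_excl_nested q (H2 := H 2) (hHG 0) (hHG 1)
  have F8 : (prodBernoulli q).real (G 0 ∩ G 1 ∩ H 2) ≤ (prodBernoulli q).real (G 0 ∩ G 1 ∩ G 2) :=
    measureReal_mono (Set.inter_subset_inter_right _ (hHG 2))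
  have ma : (prodBernoulli q).real (H 0) ≤ (prodBernoulli q).real (G 0) := measureReal_mono (hHG 0)
  have mb : (prodBernoulli q).real (H 1) ≤ (prodBernoulli q).real (G 1) := measureReal_mono (hHG 1)
  have na0 : 0 ≤ (prodBernoulli q).real (H 0) := measureReal_nonneg
  have nb0 : 0 ≤ (prodBernoulli q).real (H 1) := measureReal_nonneg
  have na1 : 0 ≤ (prodBernoulli q).real (G 0) := measureReal_nonneg
  have nb1 : 0 ≤ (prodBernoulli q).real (G 1) := measureReal_nonneg
  have hda : 0 ≤ ((prodBernoulli q).real (G 0) - (prodBernoulli q).real (H 0)) := sub_nonneg.2 ma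
  have hdb : 0 ≤ ((prodBernoulli q).real (G 1) - (prodBernoulli q).real (H 1)) := sub_nonneg.2 mb
  have hΔ : 0 ≤ ((prodBernoulli q).real (G 0) * (prodBernoulli q).real (H 1) + (prodBernoulli q).real (H 0) * (prodBernoulli q).real (G 1) - (prodBernoulli q).real (H 0) * (prodBernoulli q).real (H 1)) := by nlinarith [mul_nonneg na1 nb0, mul_nonneg na0 hdb]
  have hy : 0 ≤ (prodBernoulli q).real (H 1) * ((prodBernoulli q).real (G 0) - (prodBernoulli q).real (H 0)) + (prodBernoulli q).real (H 0) * ((prodBernoulli q).real (G 1) - (prodBernoulli q).real (H 1)) := add_nonneg (mul_nonneg nb0 hda) (mul_nonneg na0 hdb)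
  have P1 : 0 ≤ (prodBernoulli q).real (H 0 ∩ H 1 ∩ H 2) - (prodBernoulli q).real (H 0) * (prodBernoulli q).real (H 1 ∩ H 2) := by linarith
  have P2 : 0 ≤ (prodBernoulli q).real (H 0 ∩ H 1 ∩ H 2) - (prodBernoulli q).real (H 1) * (prodBernoulli q).real (H 0 ∩ H 2) := by linarith
  have P3 : 0 ≤ (prodBernoulli q).real (H 0 ∩ G 1 ∩ H 2) - (prodBernoulli q).real (G 1) * (prodBernoulli q).real (H 0 ∩ H 2) := by linarith
  have P4 : 0 ≤ (prodBernoulli q).real (G 0 ∩ H 1 ∩ H 2) - (prodBernoulli q).real (G 0) * (prodBernoulli q).real (H 1 ∩ H 2) := by linarith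
  have P5 : 0 ≤ (prodBernoulli q).real (G 0 ∩ G 1 ∩ G 2) - (prodBernoulli q).real (G 0) * (prodBernoulli q).real (G 1 ∩ G 2) := by linarith
  have P6 : 0 ≤ (prodBernoulli q).real (G 0 ∩ G 1 ∩ G 2) - (prodBernoulli q).real (G 1) * (prodBernoulli q).real (G 0 ∩ G 2) := by linarith
  have P7 : 0 ≤ (prodBernoulli q).real (H 0 ∩ H 1 ∩ H 2) - (prodBernoulli q).real (H 0 ∩ G 1 ∩ H 2) - (prodBernoulli q).real (G 0 ∩ H 1 ∩ H 2) + (prodBernoulli q).real (G 0 ∩ G 1 ∩ H 2) := by linarith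
  have P8 : 0 ≤ (prodBernoulli q).real (G 0 ∩ G 1 ∩ G 2) - (prodBernoulli q).real (G 0 ∩ G 1 ∩ H 2) := by linarith
  have F9 := prodBernoulli_harris q ((hG 0).inter (hG 1)) (hG 2) (hm _) (hm _)
  rw [iGG] at F9
  have P9 : 0 ≤ (prodBernoulli q).real (G 0 ∩ G 1 ∩ G 2) - (prodBernoulli q).real (G 0) * (prodBernoulli q).real (G 1) * (prodBernoulli q).real (G 2) := by linarith
  simp only [twoLevelForm, iGG, iHH, Fin.prod_univ_three]
  linarith [mul_nonneg (mul_nonneg (mul_nonneg na1 nb1) (mul_nonneg na1 nb0)) P1,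
    mul_nonneg (mul_nonneg (mul_nonneg na1 nb1) (mul_nonneg na0 nb1)) P2,
    mul_nonneg (mul_nonneg (mul_nonneg na1 nb1) hy) P3,
    mul_nonneg (mul_nonneg (mul_nonneg na1 nb1) hy) P4,
    mul_nonneg (mul_nonneg (mul_nonneg na1 nb1) hy) P7,
    mul_nonneg (mul_nonneg hΔ (mul_nonneg na0 nb1)) P5,
    mul_nonneg (mul_nonneg hΔ (mul_nonneg na1 nb0)) P6,
    mul_nonneg (mul_nonneg (mul_nonneg na1 nb1) hy) P8,
    mul_nonneg (mul_nonneg (add_nonneg hΔ (mul_nonneg na0 nb0)) (mul_nonneg hda hdb)) P9]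

/-- **Corollary: both two-level laws at independent tops with block bottoms, interpolation-free**, whenever the normalising factor
`Δ₊·a¹b¹` is positive (e.g. all of `G 0, G 1, H 0, H 1` of positive measure).  The unrestricted statements remain
`twoLevelForm_nonneg_of_determinedBy` / `twoLevelPlus_nonneg_of_determinedBy` of `…IndependentTops`. [this work] -/
theorem twoLevelLaws_of_blocks (q : ι → unitInterval) (T : Finset ι) (G H : Fin 3 → Set (Set ι))
    (hG : ∀ i, IsUpperSet (G i)) (hH : ∀ i, IsUpperSet (H i)) (hHG : ∀ i, H i ⊆ G i)
    (hG0 : DeterminedBy (G 0) (↑T : Set ι)ᶜ) (hG1 : DeterminedBy (G 1) (↑T : Set ι))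
    (hH0 : DeterminedBy (H 0) (↑T : Set ι)ᶜ) (hH1 : DeterminedBy (H 1) (↑T : Set ι)) 
    (hpos : 0 < ((prodBernoulli q).real (G 0) * (prodBernoulli q).real (H 1) + (prodBernoulli q).real (H 0) * (prodBernoulli q).real (G 1) - (prodBernoulli q).real (H 0) * (prodBernoulli q).real (H 1)) * (prodBernoulli q).real (G 0) * (prodBernoulli q).real (G 1)) :
    0 ≤ twoLevelForm (fun A => (prodBernoulli q).real A) G H ∧
    0 ≤ twoLevelForm (fun A => (prodBernoulli q).real A) G H
          - ∏ i, ((prodBernoulli q).real (G i) - (prodBernoulli q).real (H i)) := by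
  have h1 := twoLevelForm_mul_ge q T G H hG hH hHG hG0 hG1 hH0 hH1
  have h2 := twoLevelPlus_mul_ge q T G H hG hH hHG hG0 hG1 hH0 hH1
  have ma : (prodBernoulli q).real (H 0) ≤ (prodBernoulli q).real (G 0) := measureReal_mono (hHG 0)
  have mb : (prodBernoulli q).real (H 1) ≤ (prodBernoulli q).real (G 1) := measureReal_mono (hHG 1)
  have na0 : 0 ≤ (prodBernoulli q).real (H 0) := measureReal_nonneg
  have nb0 : 0 ≤ (prodBernoulli q).real (H 1) := measureReal_nonneg
  have na1 : 0 ≤ (prodBernoulli q).real (G 0) := measureReal_nonneg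
  have nb1 : 0 ≤ (prodBernoulli q).real (G 1) := measureReal_nonneg
  have nu0 : 0 ≤ (prodBernoulli q).real (H 2) := measureReal_nonneg
  have nu1 : 0 ≤ (prodBernoulli q).real (G 2) := measureReal_nonneg
  have hr0 : 0 ≤ (prodBernoulli q).real (H 0) * (prodBernoulli q).real (H 1) * (prodBernoulli q).real (G 0) * (prodBernoulli q).real (G 1) * ((prodBernoulli q).real (G 0) - (prodBernoulli q).real (H 0)) * ((prodBernoulli q).real (G 1) - (prodBernoulli q).real (H 1)) :=
    mul_nonneg (mul_nonneg (mul_nonneg (mul_nonneg (mul_nonneg na0 nb0) na1) nb1) (sub_nonneg.2 ma)) (sub_nonneg.2 mb)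
  refine ⟨?_, ?_⟩
  · by_contra hneg
    have hlt := mul_neg_of_pos_of_neg hpos (not_le.mp hneg)
    linarith [mul_nonneg hr0 nu0]
  · by_contra hneg
    have hlt := mul_neg_of_pos_of_neg hpos (not_le.mp hneg)
    linarith [mul_nonneg hr0 nu1]

end SahiTwoLevelIndep

end Summit.CriticalPhenomena.PercolationContinuityZ3.Theorems
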